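import Summits.Ventures.LatticeQCDFlow.Scaling.SpecificHeatFloorLog2Law
import Summits.Ventures.LatticeQCDFlow.Scaling.HaarStartProtocolLaw
import HarnessLib

/-!
HONEST FRAMING: exact (Metropolis-corrected) sampling algorithms for lattice gauge theory;
figures of merit are autocorrelation/cost numbers at stated couplings and volumes; no
continuum-physics claim.

# AnyScheduleProtocolLawEnvelope — THE MONOTONE ENVELOPE AND THE WINDOW: FOR A CONVEX FREE ENERGY THE RUNNING
# MAXIMUM OF ANY PROTOCOL COSTS NO MORE, EVERY WINDOW COSTS NO MORE THAN THE WHOLE, AND THE THREE `log²` /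
# WINDOW LAWS HOLD FOR EVERY SCHEDULE (theory2 item 130, PART 1 of 2: §1–§4, abstract)

CUSTODY: theory2 item 130 (GEN-44, HOME tier) re-landed by lean-2 per the lead's custody grant (packet member
after 125 → 126 → 127 → 128 → 129); statements and proofs = HOME/lean/theory2/AnyScheduleProtocolLaw.lean
333613e931952657 (666 l) verbatim, split below the `lint.size` line into TWO files
(`AnyScheduleProtocolLawEnvelope` §1–§4 abstract, `AnyScheduleProtocolLaw` §5–§6 lattice / Wilson, the second
importing the first); headers trimmed (PART 2 keeps the full HOME header); imports = HOME's (all tree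
modules: items 125 and 129 as landed); landing edits: six docstrings added where the lint asks and — named by
the gate's `near-duplicate` screen at the preflight dry-run — HOME's elementary `sq_div_add_mono` (≡ a lemma of
`Summits/QuantumFields/QCD/Theorems/…FreeMajorantToolkitAux.lean`) and the unused `sq_div_add_anti` DROPPED, the
single use of the former in `protocolCost_ge_sq_div_reach` inlined with its own three-line proof; no other
declaration changes (builder `build130.py` in the custodian's seat folder).

THEORY-2 item 130 (theory2 GEN-44; cell pub-lqcd / Ventures/LatticeQCDFlow).  Main theorems of the
series (PART 2): for pure `SU(n)` Wilson theory (`n ≥ 2`, `d ≥ 2`, one `c = c(n,d) > 0`, every `L ≥ 2`)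
EVERY schedule `b_0, …, b_m` of exact reweighting steps and every `i < k` with `0 ≤ b_i ≤ b_k` obey
`c·#plaq·log²((1+b_k)/(1+b_i))/((k−i) + log(…)) ≤ Σ_{j<m} log E_{μ_{b_j}}[w_j²]` and the step / window laws —
the hypothesis `Monotone b` of items 125 / 129 REMOVED.  This part (abstract, any `F` convex on `ℝ`): §1 the
one-step cost `F(x) + F(2y−x) − 2F(y) ≥ 0`, antitone in `x ≤ y`; §2 the running maximum `runMax b` is a
monotone protocol with `protocolCost F (runMax b) ≤ protocolCost F b`; §3 windows `b_i … b_k` cost no more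
than the whole; §4 the three laws for every schedule and window (`protocolCost_ge_sq_div_window(_shift)`,
`steps_necessary_window(_shift)`, `logRatio_le_of_stepCost_window(_shift)`).
-/

noncomputable section

open Finset Set Real

namespace Summit.Ventures.LatticeQCDFlow.Theory2.AnySchedule

open Summit.Ventures.LatticeQCDFlow.Theory2.SpecificHeat
open Summit.Ventures.LatticeQCDFlow.Theory2.HaarStart

/-! ## §1. One step: `c(x,y) = F(x) + F(2y − x) − 2F(y) ≥ 0`, monotone in the distance to the
target -/

section OneStep

variable {F : ℝ → ℝ}

/-- **Every exact step costs `≥ 0`**: for `F` convex on `ℝ` and ANY `x, y` (upward or downward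
step), `0 ≤ F(x) + F(2y − x) − 2F(y)` (midpoint convexity at `y`). [folklore] -/
theorem secondDiff_nonneg (hF : ConvexOn ℝ univ F) (x y : ℝ) :
    0 ≤ F x + F (2 * y - x) - 2 * F y := by
  have h := hF.2 (mem_univ x) (mem_univ (2 * y - x)) (by norm_num : (0 : ℝ) ≤ 1 / 2)
    (by norm_num : (0 : ℝ) ≤ 1 / 2) (by norm_num : (1 : ℝ) / 2 + 1 / 2 = 1)
  simp only [smul_eq_mul] at h
  rw [show (1 : ℝ) / 2 * x + 1 / 2 * (2 * y - x) = y by ring] at h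
  linarith

/-- **The step cost into a fixed target `y` is monotone in the distance**: for `F` convex on `ℝ`
and `x ≤ x' ≤ y`, `F(x') + F(2y − x') − 2F(y) ≤ F(x) + F(2y − x) − 2F(y)` (the pair
`x', 2y − x'` lies inside the segment `[x, 2y − x]`, symmetrically about `y`). [folklore] -/
theorem secondDiff_anti (hF : ConvexOn ℝ univ F) {x x' y : ℝ} (hx : x ≤ x') (hx' : x' ≤ y) :
    F x' + F (2 * y - x') - 2 * F y ≤ F x + F (2 * y - x) - 2 * F y := by
  rcases eq_or_lt_of_le hx with rfl | hlt
  · exact le_rfl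
  have hyx : y - x ≠ 0 := sub_ne_zero.2 (lt_of_lt_of_le hlt hx').ne'
  obtain ⟨a, ha0, ha1, e1, e2⟩ : ∃ a : ℝ, 0 ≤ a ∧ 0 ≤ 1 - a ∧
      a * x + (1 - a) * (2 * y - x) = x' ∧ (1 - a) * x + a * (2 * y - x) = 2 * y - x' := by
    refine ⟨(2 * y - x - x') / (2 * (y - x)), div_nonneg (by linarith) (by linarith), ?_, ?_,
      ?_⟩
    · rw [sub_nonneg, div_le_one (by linarith)]
      linarith
    · field_simp
      ring
    · field_simp
      ring
  have h1 := hF.2 (mem_univ x) (mem_univ (2 * y - x)) ha0 ha1 (by ring)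
  have h2 := hF.2 (mem_univ x) (mem_univ (2 * y - x)) ha1 ha0 (by ring)
  simp only [smul_eq_mul] at h1 h2
  rw [e1] at h1
  rw [e2] at h2
  simp only [sub_mul, one_mul] at h1 h2
  linarith

/-- Convexity on `ℝ` is translation invariant: `v ↦ F(v − a)` is convex. [folklore] -/
theorem convexOn_univ_comp_sub (hF : ConvexOn ℝ univ F) (a : ℝ) :
    ConvexOn ℝ univ (fun v => F (v - a)) := by
  refine ⟨convex_univ, fun x _ y _ p q hp hq hpq => ?_⟩
  have h := hF.2 (mem_univ (x - a)) (mem_univ (y - a)) hp hq hpq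
  simp only [smul_eq_mul] at h ⊢
  rwa [show p * (x - a) + q * (y - a) = p * x + q * y - a by linear_combination (-a) * hpq] at h

end OneStep

/-! ## §2. The monotone envelope: the running maximum of a protocol costs termwise less -/

section Envelope

variable {n : ℕ} {F : ℝ → ℝ}

/-- The running maximum `M_j = max_{l ≤ j} b_l` of a protocol. [folklore] -/
def runMax (b : Fin (n + 1) → ℝ) (j : Fin (n + 1)) : ℝ :=
  (Finset.Iic j).sup' ⟨j, Finset.mem_Iic.2 le_rfl⟩ b

/-- `b l ≤ runMax b j` for `l ≤ j`. [folklore] -/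
theorem le_runMax (b : Fin (n + 1) → ℝ) {l j : Fin (n + 1)} (h : l ≤ j) : b l ≤ runMax b j :=
  Finset.le_sup' b (Finset.mem_Iic.2 h)

/-- `runMax b 0 = b 0`. [folklore] -/
theorem runMax_zero (b : Fin (n + 1) → ℝ) : runMax b 0 = b 0 := by
  refine le_antisymm (Finset.sup'_le _ _ fun l hl => ?_) (le_runMax b le_rfl)
  rw [Finset.mem_Iic, Fin.le_zero_iff] at hl
  rw [hl]

/-- The running maximum is monotone. [folklore] -/
theorem runMax_monotone (b : Fin (n + 1) → ℝ) : Monotone (runMax b) := fun _ _ h =>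
  Finset.sup'_le _ _ fun _ hl => le_runMax b ((Finset.mem_Iic.1 hl).trans h)

/-- `runMax b (j+1) ≤ max (runMax b j) (b (j+1))`. [folklore] -/
theorem runMax_succ_le (b : Fin (n + 1) → ℝ) (j : Fin n) :
    runMax b j.succ ≤ max (runMax b j.castSucc) (b j.succ) := by
  refine Finset.sup'_le _ _ fun l hl => ?_
  rcases (Finset.mem_Iic.1 hl).eq_or_lt with h | h
  · rw [h]
    exact le_max_right _ _
  · exact (le_runMax b (Fin.le_castSucc_iff.2 h)).trans (le_max_left _ _)

/-- **Step dichotomy**: a step of the running maximum is either NULL (`M_{j+1} = M_j`) or a RECORD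
(`M_{j+1} = b_{j+1}` with `b_j ≤ M_j ≤ b_{j+1}`). [folklore] -/
theorem runMax_step (b : Fin (n + 1) → ℝ) (j : Fin n) :
    runMax b j.succ = runMax b j.castSucc ∨
      (runMax b j.succ = b j.succ ∧ b j.castSucc ≤ runMax b j.castSucc ∧
        runMax b j.castSucc ≤ b j.succ) := by
  have hmono := runMax_monotone b (Fin.castSucc_le_succ j)
  have hup := runMax_succ_le b j
  rcases le_or_gt (b j.succ) (runMax b j.castSucc) with h | h
  · exact Or.inl (le_antisymm (hup.trans (max_le le_rfl h)) hmono)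
  · exact Or.inr ⟨le_antisymm (hup.trans (max_le h.le le_rfl)) (le_runMax b le_rfl),
      le_runMax b le_rfl, h.le⟩

/-- **Termwise domination**: every step of the running maximum costs at most the same step of
the protocol (a null step costs `0 ≤` anything by `secondDiff_nonneg`; a record step enters the
same target `b_{j+1}` from `M_j ≥ b_j`, `secondDiff_anti`). [ours] -/
theorem stepCost_runMax_le (hF : ConvexOn ℝ univ F) (b : Fin (n + 1) → ℝ) (j : Fin n) :
    F (runMax b j.castSucc) + F (2 * runMax b j.succ - runMax b j.castSucc) -
        2 * F (runMax b j.succ) ≤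
      F (b j.castSucc) + F (2 * b j.succ - b j.castSucc) - 2 * F (b j.succ) := by
  rcases runMax_step b j with h | ⟨h, h1, h2⟩
  · rw [h, show 2 * runMax b j.castSucc - runMax b j.castSucc = runMax b j.castSucc by ring]
    have := secondDiff_nonneg hF (b j.castSucc) (b j.succ)
    linarith
  · rw [h]
    exact secondDiff_anti hF h1 h2

/-- **The monotone envelope costs less**: `protocolCost F (runMax b) ≤ protocolCost F b` for
EVERY protocol `b` and every `F` convex on `ℝ`. [ours] -/
theorem protocolCost_runMax_le (hF : ConvexOn ℝ univ F) (b : Fin (n + 1) → ℝ) :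
    protocolCost F (runMax b) ≤ protocolCost F b :=
  Finset.sum_le_sum fun j _ => stepCost_runMax_le hF b j

/-- **`log²` LAW FOR A PROTOCOL THAT REACHES `b_k`** (no monotonicity).  If `F` is convex on `ℝ`
and `F + K log` is convex on `[β₀, ∞)` (`β₀ > 0`, `K ≥ 0`), then EVERY protocol `b_0, …, b_n`
(`n ≥ 1`) with `β₀ ≤ b_0 ≤ b_k` for some index `k` obeys, with `U = log(b_k/b_0)`:
**`K·U²/(n + U) ≤ protocolCost F b`**. [ours] -/
theorem protocolCost_ge_sq_div_reach {K β₀ : ℝ} (hβ₀ : 0 < β₀) (hK : 0 ≤ K)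
    (hF : ConvexOn ℝ univ F) (hG : ConvexOn ℝ (Ici β₀) (fun β => F β + K * Real.log β))
    (hn : 0 < n) (b : Fin (n + 1) → ℝ) (hb0 : β₀ ≤ b 0) (k : Fin (n + 1)) (hbk : b 0 ≤ b k) :
    K * (Real.log (b k / b 0)) ^ 2 / (n + Real.log (b k / b 0)) ≤ protocolCost F b := by
  have hM0 : runMax b 0 = b 0 := runMax_zero b
  have hMk : b k ≤ runMax b (Fin.last n) := le_runMax b (Fin.le_last k)
  have hb0' : 0 < b 0 := lt_of_lt_of_le hβ₀ hb0
  have hU : 0 ≤ Real.log (b k / b 0) := Real.log_nonneg ((one_le_div hb0').2 hbk)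
  have hUU' : Real.log (b k / b 0) ≤ Real.log (runMax b (Fin.last n) / runMax b 0) := by
    rw [hM0]
    exact Real.log_le_log (div_pos (lt_of_lt_of_le hb0' hbk) hb0')
      (div_le_div_of_nonneg_right hMk hb0'.le)
  have h1 := protocolCost_ge_sq_div hβ₀ hK hG hn (runMax b) (by rw [hM0]; exact hb0)
    (runMax_monotone b)
  have hn' : (0 : ℝ) < n := by exact_mod_cast hn
  calc K * (Real.log (b k / b 0)) ^ 2 / (n + Real.log (b k / b 0))
      = K * ((Real.log (b k / b 0)) ^ 2 / (n + Real.log (b k / b 0))) := by ring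
    _ ≤ K * ((Real.log (runMax b (Fin.last n) / runMax b 0)) ^ 2 /
          (n + Real.log (runMax b (Fin.last n) / runMax b 0))) :=
        mul_le_mul_of_nonneg_left (by
          -- inlined `U ↦ U²/(c+U)` monotonicity (HOME `sq_div_add_mono`, a near-duplicate of a tree lemma)
          rw [div_le_div_iff₀ (by linarith) (by linarith)]
          have h := mul_nonneg (sub_nonneg.2 hUU') (add_nonneg (mul_nonneg hn'.le
            (add_nonneg (hU.trans hUU') hU)) (mul_nonneg hU (hU.trans hUU')))
          nlinarith [h]) hK
    _ = K * (Real.log (runMax b (Fin.last n) / runMax b 0)) ^ 2 /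
          (n + Real.log (runMax b (Fin.last n) / runMax b 0)) := by ring
    _ ≤ protocolCost F (runMax b) := h1
    _ ≤ protocolCost F b := protocolCost_runMax_le hF b

/-- **WINDOW LAW FOR A PROTOCOL THAT REACHES `b_k`**: if every step costs `≤ t₀` (`K > 0`) then
`log(b_k/b_0) ≤ n·(t₀/K + √(t₀/K))` — for EVERY protocol with `β₀ ≤ b_0 ≤ b_k`. [ours] -/
theorem logRatio_le_of_stepCost_reach {K β₀ t₀ : ℝ} (hβ₀ : 0 < β₀) (hK : 0 < K)
    (hF : ConvexOn ℝ univ F) (hG : ConvexOn ℝ (Ici β₀) (fun β => F β + K * Real.log β))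
    (b : Fin (n + 1) → ℝ) (hb0 : β₀ ≤ b 0) (k : Fin (n + 1)) (hbk : b 0 ≤ b k) (ht : 0 ≤ t₀)
    (hstep : ∀ j : Fin n,
      F (b j.castSucc) + F (2 * b j.succ - b j.castSucc) - 2 * F (b j.succ) ≤ t₀) :
    Real.log (b k / b 0) ≤ n * (t₀ / K + Real.sqrt (t₀ / K)) := by
  have hM0 : runMax b 0 = b 0 := runMax_zero b
  have hb0' : 0 < b 0 := lt_of_lt_of_le hβ₀ hb0
  have h := logRatio_le_of_stepCost hβ₀ hK hG (runMax b) (by rw [hM0]; exact hb0)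
    (runMax_monotone b) ht fun j => (stepCost_runMax_le hF b j).trans (hstep j)
  refine le_trans ?_ h
  rw [hM0]
  exact Real.log_le_log (div_pos (lt_of_lt_of_le hb0' hbk) hb0')
    (div_le_div_of_nonneg_right (le_runMax b (Fin.le_last k)) hb0'.le)

end Envelope

/-! ## §3. Windows: the segment `b_i, …, b_k` of a protocol is a protocol with `k − i` steps
and smaller cost -/

section Window

variable {n : ℕ} {F : ℝ → ℝ}

/-- The window `b_i, b_{i+1}, …, b_k` of a protocol, as a protocol with `k − i` steps
(for `k < i` it is the one-point protocol `b_i`). [folklore] -/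
def window (b : Fin (n + 1) → ℝ) (i k : Fin (n + 1)) : Fin ((k : ℕ) - (i : ℕ) + 1) → ℝ :=
  fun j => b ⟨(i : ℕ) + (j : ℕ), by have := j.2; have := i.2; have := k.2; omega⟩

/-- The window starts at `b i`. [folklore] -/
theorem window_zero (b : Fin (n + 1) → ℝ) (i k : Fin (n + 1)) : window b i k 0 = b i :=
  congrArg b (Fin.ext (by simp))

/-- The window ends at `b k` (`i ≤ k`). [folklore] -/
theorem window_last (b : Fin (n + 1) → ℝ) {i k : Fin (n + 1)} (hik : i ≤ k) :
    window b i k (Fin.last _) = b k :=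
  congrArg b (Fin.ext (by have := Fin.le_def.1 hik; simp only [Fin.val_last]; omega))

/-- **A window costs less than the whole protocol** (every dropped step costs `≥ 0`). [ours] -/
theorem protocolCost_window_le (hF : ConvexOn ℝ univ F) (b : Fin (n + 1) → ℝ)
    (i k : Fin (n + 1)) : protocolCost F (window b i k) ≤ protocolCost F b := by
  classical
  let e : Fin ((k : ℕ) - (i : ℕ)) ↪ Fin n :=
    ⟨fun j => ⟨(i : ℕ) + (j : ℕ), by have := j.2; have := k.2; omega⟩, fun j j' h => by
      simpa [Fin.ext_iff] using h⟩
  have h1 : protocolCost F (window b i k) =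
      ∑ l ∈ Finset.univ.map e,
        (F (b l.castSucc) + F (2 * b l.succ - b l.castSucc) - 2 * F (b l.succ)) := by
    rw [Finset.sum_map]
    rfl
  rw [h1]
  exact Finset.sum_le_sum_of_subset_of_nonneg (Finset.subset_univ _) fun l _ _ =>
    secondDiff_nonneg hF (b l.castSucc) (b l.succ)

/-- Every step of a window is a step of the protocol: a per-step bound transfers. [folklore] -/
theorem stepCost_window_le (b : Fin (n + 1) → ℝ) (i k : Fin (n + 1)) {t₀ : ℝ}
    (hstep : ∀ j : Fin n,
      F (b j.castSucc) + F (2 * b j.succ - b j.castSucc) - 2 * F (b j.succ) ≤ t₀)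
    (j : Fin ((k : ℕ) - (i : ℕ))) :
    F (window b i k j.castSucc) + F (2 * window b i k j.succ - window b i k j.castSucc) -
      2 * F (window b i k j.succ) ≤ t₀ :=
  hstep ⟨(i : ℕ) + (j : ℕ), by have := j.2; have := k.2; omega⟩

end Window

/-! ## §4. The three laws for every schedule and every window (abstract) -/

section Laws

variable {n : ℕ} {F : ℝ → ℝ}

/-- **THE `log²` LAW FOR EVERY SCHEDULE AND EVERY WINDOW.**  If `F` is convex on `ℝ` and
`F + K log` is convex on `[β₀, ∞)` (`β₀ > 0`, `K ≥ 0`), then for EVERY protocol `b_0, …, b_n`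
and all indices `i < k` with `β₀ ≤ b_i ≤ b_k`, with `U = log(b_k/b_i)`:
**`K·U²/((k − i) + U) ≤ protocolCost F b`**. [ours] -/
theorem protocolCost_ge_sq_div_window {K β₀ : ℝ} (hβ₀ : 0 < β₀) (hK : 0 ≤ K)
    (hF : ConvexOn ℝ univ F) (hG : ConvexOn ℝ (Ici β₀) (fun β => F β + K * Real.log β))
    (b : Fin (n + 1) → ℝ) {i k : Fin (n + 1)} (hik : i < k) (hi : β₀ ≤ b i) (hbk : b i ≤ b k) :
    K * (Real.log (b k / b i)) ^ 2 / (((k : ℕ) - (i : ℕ) : ℝ) + Real.log (b k / b i)) ≤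
      protocolCost F b := by
  have hik' := Fin.lt_def.1 hik
  have h := protocolCost_ge_sq_div_reach hβ₀ hK hF hG (n := (k : ℕ) - (i : ℕ)) (by omega)
    (window b i k) (by rw [window_zero]; exact hi) (Fin.last _)
    (by rw [window_zero, window_last b hik.le]; exact hbk)
  rw [window_zero, window_last b hik.le, Nat.cast_sub hik'.le] at h
  exact h.trans (protocolCost_window_le hF b i k)

/-- **STEPS NECESSARY BETWEEN `b_i` AND `b_k`**: if the whole protocol costs `≤ t` (`t > 0`) then
**`k − i ≥ K·log²(b_k/b_i)/t − log(b_k/b_i)`**. [ours] -/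
theorem steps_necessary_window {K β₀ t : ℝ} (hβ₀ : 0 < β₀) (hK : 0 ≤ K)
    (hF : ConvexOn ℝ univ F) (hG : ConvexOn ℝ (Ici β₀) (fun β => F β + K * Real.log β))
    (b : Fin (n + 1) → ℝ) {i k : Fin (n + 1)} (hik : i < k) (hi : β₀ ≤ b i) (hbk : b i ≤ b k)
    (ht : 0 < t) (hcost : protocolCost F b ≤ t) :
    K * (Real.log (b k / b i)) ^ 2 / t - Real.log (b k / b i) ≤ ((k : ℕ) - (i : ℕ) : ℝ) := by
  have hik' := Fin.lt_def.1 hik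
  have hU : 0 ≤ Real.log (b k / b i) :=
    Real.log_nonneg ((one_le_div (lt_of_lt_of_le hβ₀ hi)).2 hbk)
  have hm : (0 : ℝ) < ((k : ℕ) - (i : ℕ) : ℝ) := by
    have : ((i : ℕ) : ℝ) < ((k : ℕ) : ℝ) := by exact_mod_cast hik'
    linarith
  have h := (protocolCost_ge_sq_div_window hβ₀ hK hF hG b hik hi hbk).trans hcost
  rw [div_le_iff₀ (by linarith)] at h
  rw [sub_le_iff_le_add, div_le_iff₀ ht]
  linarith

/-- **WINDOW LAW FOR EVERY SCHEDULE**: if every step costs `≤ t₀` (`t₀ ≥ 0`, `K > 0`) then for all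
`i ≤ k` with `β₀ ≤ b_i ≤ b_k`: **`log(b_k/b_i) ≤ (k − i)·(t₀/K + √(t₀/K))`** — any `k − i`
consecutive exact steps with `O(1)` windows climb at most that much in `log β`, whatever the
schedule does elsewhere. [ours] -/
theorem logRatio_le_of_stepCost_window {K β₀ t₀ : ℝ} (hβ₀ : 0 < β₀) (hK : 0 < K)
    (hF : ConvexOn ℝ univ F) (hG : ConvexOn ℝ (Ici β₀) (fun β => F β + K * Real.log β))
    (b : Fin (n + 1) → ℝ) {i k : Fin (n + 1)} (hik : i ≤ k) (hi : β₀ ≤ b i) (hbk : b i ≤ b k)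
    (ht : 0 ≤ t₀)
    (hstep : ∀ j : Fin n,
      F (b j.castSucc) + F (2 * b j.succ - b j.castSucc) - 2 * F (b j.succ) ≤ t₀) :
    Real.log (b k / b i) ≤ ((k : ℕ) - (i : ℕ) : ℝ) * (t₀ / K + Real.sqrt (t₀ / K)) := by
  have h := logRatio_le_of_stepCost_reach hβ₀ hK hF hG (window b i k)
    (by rw [window_zero]; exact hi) (Fin.last _)
    (by rw [window_zero, window_last b hik]; exact hbk) ht (stepCost_window_le b i k hstep)
  rwa [window_zero, window_last b hik, Nat.cast_sub (Fin.le_def.1 hik)] at h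

/-- **SHIFTED `log²` LAW FOR EVERY SCHEDULE AND WINDOW** (item 129's all-coupling form without
`Monotone`): if `F` is convex on `ℝ` and `v ↦ F(v − 1) + K log v` is convex on `[1, ∞)`
(`K ≥ 0`), then for every protocol and all `i < k` with `0 ≤ b_i ≤ b_k`, with
`U = log((1+b_k)/(1+b_i))`: **`K·U²/((k − i) + U) ≤ protocolCost F b`**. [ours] -/
theorem protocolCost_ge_sq_div_window_shift {K : ℝ} (hK : 0 ≤ K) (hF : ConvexOn ℝ univ F)
    (hG : ConvexOn ℝ (Ici 1) (fun v => F (v - 1) + K * Real.log v))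
    (b : Fin (n + 1) → ℝ) {i k : Fin (n + 1)} (hik : i < k) (hi : 0 ≤ b i) (hbk : b i ≤ b k) :
    K * (Real.log ((1 + b k) / (1 + b i))) ^ 2 /
        (((k : ℕ) - (i : ℕ) : ℝ) + Real.log ((1 + b k) / (1 + b i))) ≤ protocolCost F b := by
  have h := protocolCost_ge_sq_div_window (F := fun v => F (v - 1)) one_pos hK
    (convexOn_univ_comp_sub hF 1) hG (fun j => 1 + b j) hik
    (show (1 : ℝ) ≤ 1 + b i by linarith) (show 1 + b i ≤ 1 + b k by linarith)
  rwa [protocolCost_shift] at h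

/-- **SHIFTED STEPS NECESSARY**: total cost `≤ t` forces
**`k − i ≥ K·log²((1+b_k)/(1+b_i))/t − log((1+b_k)/(1+b_i))`**. [ours] -/
theorem steps_necessary_window_shift {K t : ℝ} (hK : 0 ≤ K) (hF : ConvexOn ℝ univ F)
    (hG : ConvexOn ℝ (Ici 1) (fun v => F (v - 1) + K * Real.log v))
    (b : Fin (n + 1) → ℝ) {i k : Fin (n + 1)} (hik : i < k) (hi : 0 ≤ b i) (hbk : b i ≤ b k)
    (ht : 0 < t) (hcost : protocolCost F b ≤ t) :
    K * (Real.log ((1 + b k) / (1 + b i))) ^ 2 / t - Real.log ((1 + b k) / (1 + b i)) ≤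
      ((k : ℕ) - (i : ℕ) : ℝ) := by
  rw [← protocolCost_shift F 1 b] at hcost
  exact steps_necessary_window (F := fun v => F (v - 1)) one_pos hK (convexOn_univ_comp_sub hF 1)
    hG (fun j => 1 + b j) hik (show (1 : ℝ) ≤ 1 + b i by linarith)
    (show 1 + b i ≤ 1 + b k by linarith) ht hcost

/-- **SHIFTED WINDOW LAW FOR EVERY SCHEDULE**: every step `≤ t₀` forces
**`log((1+b_k)/(1+b_i)) ≤ (k − i)·(t₀/K + √(t₀/K))`** for all `i ≤ k` with `0 ≤ b_i ≤ b_k`.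
[ours] -/
theorem logRatio_le_of_stepCost_window_shift {K t₀ : ℝ} (hK : 0 < K) (hF : ConvexOn ℝ univ F)
    (hG : ConvexOn ℝ (Ici 1) (fun v => F (v - 1) + K * Real.log v))
    (b : Fin (n + 1) → ℝ) {i k : Fin (n + 1)} (hik : i ≤ k) (hi : 0 ≤ b i) (hbk : b i ≤ b k)
    (ht : 0 ≤ t₀)
    (hstep : ∀ j : Fin n,
      F (b j.castSucc) + F (2 * b j.succ - b j.castSucc) - 2 * F (b j.succ) ≤ t₀) :
    Real.log ((1 + b k) / (1 + b i)) ≤ ((k : ℕ) - (i : ℕ) : ℝ) * (t₀ / K + Real.sqrt (t₀ / K)) := by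
  refine logRatio_le_of_stepCost_window (F := fun v => F (v - 1)) one_pos hK
    (convexOn_univ_comp_sub hF 1) hG (fun j => 1 + b j) hik (show (1 : ℝ) ≤ 1 + b i by linarith)
    (show 1 + b i ≤ 1 + b k by linarith) ht fun j => ?_
  have e : 2 * (1 + b j.succ) - (1 + b j.castSucc) - 1 = 2 * b j.succ - b j.castSucc := by ring
  show F (1 + b j.castSucc - 1) + F (2 * (1 + b j.succ) - (1 + b j.castSucc) - 1) -
      2 * F (1 + b j.succ - 1) ≤ t₀
  rw [add_sub_cancel_left, add_sub_cancel_left, e]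
  exact hstep j

end Laws

end Summit.Ventures.LatticeQCDFlow.Theory2.AnySchedule

end
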